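import Summits.Ventures.HSemireg.WedgeHankelRecurrenceCommonRoots
import Literature.AlgebraicGeometry.Motives.ZetaFunctionProofs

/-!
# Venture HSemireg — COUNTING THE RATIONAL ROOTS OVER A FINITE FIELD BY HANKEL RANKS: for `K` finite with `q` elements and `m ∈ K[X]` monic of degree `t + 1`,
# **`rank H_t(m′/m) − rank H_t((X^q − X)·m′/m) = #{c ∈ K : m(c) = 0 ∧ e_c ≠ 0 in K}`** — the number of DISTINCT `K`-RATIONAL roots whose multiplicity is prime to the characteristic is
# the drop in rank of the Hankel matrix of the Newton sums when they are weighted by `X^q − X` (N113's common-root count with the weight `a = X^q − X`, whose roots in any extension are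
# exactly the elements of `K`); everything in the statement lives over `K` (both ranks and the count), the splitting field enters only the proof.

HONEST FRAMING. Part of the Lean index of the computation cell `pub-hsemireg` (seat p10 gen 32, Sunday typer «UNIFORM-IN-n»).
LINEAR ALGEBRA OF HANKEL (catalecticant) MATRICES and of polynomials over a (finite) field ONLY (`FiniteField.pow_card`, `Polynomial.roots`, `Polynomial.rootMultiplicity`): no variety, no cohomology
theory, no sheaf, no Ext group and no semiregularity map is constructed here; nothing here says that HC / HC_CM / HC_AV holds; no Literature FACT is declared or used — one PROVED Literature
folklore lemma is imported (`Literature.AlgebraicGeometry.Motives.mem_range_of_pow_card_eq`: `y^{|L|} = y ⇒ y ∈ L` for a finite field `L` inside any field; Serre §1.6 ∕ Hartshorne App. C; the same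
lemma is also proved in `Literature/NumberTheory/EllipticCurves/LocalFrobeniusResidueProofs` and three more files — reused here, NOT re-proved).  Custodian versions as in `WedgeHankelSiegelIdeal` (1/3).

WHAT IS IN THE TREE.  N113 (`WedgeHankelRecurrenceCommonRoots`): `rank_hankelSq_dualSeq_mul_derivative_add_card_common` (`rank H_t(a·m′/m) + #{λ ∈ roots(φm) : e_λ ≠ 0 ∧ (φa)(λ) = 0} = rank H_t(m′/m)`).
Mathlib: `FiniteField.pow_card` (`c^q = c`), `FiniteField.roots_X_pow_card_sub_X` (the roots of `X^q − X` IN `K`), `Polynomial.eq_rootMultiplicity_map`, `SplittingField.splits`; PROVED Literature `Algebra/Polynomial/BerlekampSubalgebra` ∕ `DistinctDegreeFactorization` (counting irreducible factors ∕ the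
`gcd(f, X^{q^d} − X)` filtration) — the classical count of rational roots is `deg gcd(m, X^q − X)`; the Hankel-rank form below is this lineage's (no statement of it found by `rg` in the tree or Mathlib).
THIS FILE (namespace `Summit.Ventures.HSemireg.Wedge.HankelOuter` continued; CHAINED on N113; 0 definitions):
* §686 `isRoot_map_X_pow_card_sub_X_iff` (in any field `L ⊇ K`, `λ` is a root of `X^q − X` iff `λ ∈ K` — the imported folklore lemma + `c^q = c`), `card_filter_roots_map_eq_card_filter` (the distinct roots of
  `φm` lying in `K` with `e ≠ 0`, counted in `L`, are the distinct roots of `m` in `K` with `e ≠ 0`).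
* §687 **`rank_hankelSq_dualSeq_X_pow_card_sub_X_mul_derivative_add_card`** (THE RATIONAL ROOT COUNT: `rank H_t((X^q − X)·m′/m) + #{c ∈ K : m.IsRoot c ∧ (e_c : K) ≠ 0} = rank H_t(m′/m)`),
  `card_filter_isRoot_le_rank_hankelSq_dualSeq_derivative` (hence `#{such c} ≤ rank H_t(m′/m)`), `rank_hankelSq_dualSeq_X_pow_card_sub_X_mul_derivative_eq_iff` (no rank drop ⟺ no rational root of
  multiplicity prime to `p`).
Nothing Ext-side.  New names only.
-/

open Module Polynomial
open scoped Matrix Polynomial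

namespace Summit.Ventures.HSemireg.Wedge.HankelOuter

open Summit.Ventures.HSemireg.Wedge Summit.Ventures.HSemireg.Wedge.Hankel

variable (K : Type*) [Field K]

/-! ## §686. The roots of `X^q − X` in an extension of the field with `q` elements -/

/-- `λ ∈ L` is a root of `(X^q − X).map φ` iff `λ` lies in (the image of) `K`. -/
theorem isRoot_map_X_pow_card_sub_X_iff [Fintype K] [DecidableEq K] {L : Type*} [Field L] [DecidableEq L] (φ : K →+* L) (c : L) :
    ((Polynomial.X ^ Fintype.card K - Polynomial.X : K[X]).map φ).IsRoot c ↔ c ∈ Set.range φ := by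
  rw [Polynomial.map_sub, Polynomial.map_pow, Polynomial.map_X, Polynomial.IsRoot, eval_sub, eval_pow, eval_X, sub_eq_zero]
  refine ⟨fun h => Literature.AlgebraicGeometry.Motives.mem_range_of_pow_card_eq φ (by rwa [Nat.card_eq_fintype_card]), ?_⟩
  rintro ⟨a, rfl⟩
  rw [← map_pow, FiniteField.pow_card]

/-- The distinct roots of `φm` (`m ≠ 0`) lying in `K` with multiplicity non-zero in `L` are in bijection (via `φ`) with the distinct roots of `m` in `K` with multiplicity non-zero in `K`. -/
theorem card_filter_roots_map_eq_card_filter [Fintype K] [DecidableEq K] {L : Type*} [Field L] [DecidableEq L] (φ : K →+* L) {m : K[X]} (hm : m ≠ 0) :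
    ((m.map φ).roots.toFinset.filter fun c => (((m.map φ).roots.count c : ℕ) : L) ≠ 0 ∧ ((Polynomial.X ^ Fintype.card K - Polynomial.X : K[X]).map φ).IsRoot c).card
      = ((Finset.univ : Finset K).filter fun a => m.IsRoot a ∧ ((rootMultiplicity a m : ℕ) : K) ≠ 0).card := by
  rw [← Finset.card_image_of_injective ((Finset.univ : Finset K).filter fun a => m.IsRoot a ∧ ((rootMultiplicity a m : ℕ) : K) ≠ 0) φ.injective]
  congr 1
  ext c
  simp only [Finset.mem_filter, Finset.mem_image, Finset.mem_univ, true_and, Multiset.mem_toFinset, isRoot_map_X_pow_card_sub_X_iff, Set.mem_range, ne_eq]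
  constructor
  · rintro ⟨hc, hmult, ⟨a, rfl⟩⟩
    refine ⟨a, ⟨?_, ?_⟩, rfl⟩
    · rwa [Polynomial.mem_roots (Polynomial.map_ne_zero hm), Polynomial.IsRoot, Polynomial.eval_map, Polynomial.eval₂_hom, map_eq_zero] at hc
    · rwa [count_roots, ← Polynomial.eq_rootMultiplicity_map φ.injective, ← map_natCast φ, map_eq_zero] at hmult
  · rintro ⟨a, ⟨ha, hmult⟩, rfl⟩
    refine ⟨?_, ?_, a, rfl⟩
    · rw [Polynomial.mem_roots (Polynomial.map_ne_zero hm), Polynomial.IsRoot, Polynomial.eval_map, Polynomial.eval₂_hom, map_eq_zero]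
      exact ha
    · rw [count_roots, ← Polynomial.eq_rootMultiplicity_map φ.injective, ← map_natCast φ, map_eq_zero]
      exact hmult

/-! ## §687. The rational root count -/

/-- **COUNTING RATIONAL ROOTS OVER A FINITE FIELD BY HANKEL RANKS: `rank H_t((X^q − X)·m′/m) + #{c ∈ K : m(c) = 0 ∧ e_c ≠ 0 in K} = rank H_t(m′/m)`** for `K` finite with `q` elements and `m`
monic of degree `t + 1` — the distinct `K`-rational roots of multiplicity prime to the characteristic are counted by the rank DROP under the weight `X^q − X` (N113 in the splitting field,
whose roots of `X^q − X` are exactly the elements of `K`).  All objects in the statement are over `K`. -/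
theorem rank_hankelSq_dualSeq_X_pow_card_sub_X_mul_derivative_add_card [Fintype K] [DecidableEq K] {t : ℕ} {m : K[X]} (hm : m.Monic) (hmd : m.natDegree = t + 1) :
    (hankelSq K t (dualSeq K m ((Polynomial.X ^ Fintype.card K - Polynomial.X) * derivative m))).rank
      + ((Finset.univ : Finset K).filter fun a => m.IsRoot a ∧ ((rootMultiplicity a m : ℕ) : K) ≠ 0).card = (hankelSq K t (dualSeq K m (derivative m))).rank := by
  classical
  rw [← card_filter_roots_map_eq_card_filter K (algebraMap K m.SplittingField) hm.ne_zero]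
  exact rank_hankelSq_dualSeq_mul_derivative_add_card_common K (algebraMap K m.SplittingField) hm hmd (SplittingField.splits m) _

/-- Hence `#{c ∈ K : m(c) = 0 ∧ e_c ≠ 0 in K} ≤ rank H_t(m′/m)` (`K` finite, `m` monic of degree `t + 1`). -/
theorem card_filter_isRoot_le_rank_hankelSq_dualSeq_derivative [Fintype K] [DecidableEq K] {t : ℕ} {m : K[X]} (hm : m.Monic) (hmd : m.natDegree = t + 1) :
    ((Finset.univ : Finset K).filter fun a => m.IsRoot a ∧ ((rootMultiplicity a m : ℕ) : K) ≠ 0).card ≤ (hankelSq K t (dualSeq K m (derivative m))).rank := by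
  rw [← rank_hankelSq_dualSeq_X_pow_card_sub_X_mul_derivative_add_card K hm hmd]
  exact Nat.le_add_left _ _

/-- **No rank drop ⟺ no rational root of multiplicity prime to the characteristic**: `rank H_t((X^q − X)·m′/m) = rank H_t(m′/m) ⟺ ∀ c ∈ K, m(c) = 0 → e_c = 0 in K`. -/
theorem rank_hankelSq_dualSeq_X_pow_card_sub_X_mul_derivative_eq_iff [Fintype K] [DecidableEq K] {t : ℕ} {m : K[X]} (hm : m.Monic) (hmd : m.natDegree = t + 1) :
    (hankelSq K t (dualSeq K m ((Polynomial.X ^ Fintype.card K - Polynomial.X) * derivative m))).rank = (hankelSq K t (dualSeq K m (derivative m))).rank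
      ↔ ∀ a : K, m.IsRoot a → ((rootMultiplicity a m : ℕ) : K) = 0 := by
  have h := rank_hankelSq_dualSeq_X_pow_card_sub_X_mul_derivative_add_card K hm hmd
  constructor
  · intro heq a ha
    have h0 : ((Finset.univ : Finset K).filter fun a => m.IsRoot a ∧ ((rootMultiplicity a m : ℕ) : K) ≠ 0).card = 0 := by omega
    by_contra hne
    exact Finset.card_ne_zero_of_mem (Finset.mem_filter.mpr ⟨Finset.mem_univ a, ha, hne⟩) h0
  · intro hall
    have h0 : ((Finset.univ : Finset K).filter fun a => m.IsRoot a ∧ ((rootMultiplicity a m : ℕ) : K) ≠ 0).card = 0 :=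
      Finset.card_eq_zero.mpr (Finset.filter_eq_empty_iff.mpr fun a _ hand => hand.2 (hall a hand.1))
    omega

end Summit.Ventures.HSemireg.Wedge.HankelOuter
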